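import Literature.Barriers.CriticalPhenomena.RigorousRGSmallParameterHHWThm11Holds
import Literature.Barriers.CriticalPhenomena.RigorousRGSmallParameterSusceptibilityLimits
import HarnessLib

/-!
# `RigorousRGSmallParameterNarrow` is now equivalent to Slade's Theorem 1.4.1 alone — the
# Hara–Hattori–Watanabe conjunct being PROVED — and follows from Proposition 8.2.2 (one leaf)

Companion of `RigorousRGSmallParameterProofs.lean` (which vendors the narrowed barrier
`RigorousRGSmallParameterNarrow := RigorousRGSmallParameter ∧ HaraHattoriWatanabe2001_thm11`),
`RigorousRGSmallParameterNarrowReduction.lean` (the narrowed barrier from its printed leaves) and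
`RigorousRGSmallParameterHHWThm11Holds.lean` (the discharge `HaraHattoriWatanabe2001_thm11_holds`:
Hara–Hattori–Watanabe, Comm. Math. Phys. 220 (2001) 13–40, Theorem 1.1, `d = 4`, assembled from
the corrected Theorem 2.1, the certified Theorem 2.2 and the certified strip (2.13) at
`70 ≤ N < 100`).

With the second conjunct a theorem of the tree, the narrowed barrier collapses onto the original
one: `RigorousRGSmallParameterNarrow ↔ RigorousRGSmallParameter ↔ LongRangePhi4.Slade2017_thm141`
(Slade, *Critical exponents for long-range `O(n)` models below the upper critical dimension*,
Commun. Math. Phys. 358 (2018) 343–436, arXiv:1611.06169, Theorem 1.4.1, first display, `n ≥ 1`),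
and — composing with the PROVED real-analysis chain of the sibling files (§8.3: Theorem 8.3.1 and
"Proof of Theorem 1.4.1", `RigorousRGSmallParameterCriticalPoint` / `…SladeReduction`; §8.2: the
limit/derivative interchange, `…SusceptibilityLimits`) — it follows from the single named fact
`LongRangePhi4.Slade2017_prop822` (Proposition 8.2.2 with the first display after Remark 8.2.3 and
Corollaries 7.2.4–7.2.5: the output of the renormalisation-group flow of §5–§8.1 on
[BS-rg-IV, BS-rg-V, BS-rg-step]). The unproved remainder of `RigorousRGSmallParameterNarrow` is
thereby exactly `Slade2017_prop822`; once `Slade2017_prop822_holds` (equivalently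
`RigorousRGSmallParameter_holds`) exists, `RigorousRGSmallParameterNarrow_holds` is
`rigorousRGSmallParameterNarrow_of_prop822 Slade2017_prop822_holds`.

Everything here is proved; no named fact is introduced (D-0026). Axioms: the whitelist plus the
two `native_decide` certificate auxiliaries inherited from `HaraHattoriWatanabe2001_thm11_holds`
(`Thm22Cert.cert_ok`, `Thm22Cert.strip_cert_ok`, Hara–Hattori–Watanabe §5 / Proposition 5.1).

## References

* G. Slade, Commun. Math. Phys. 358 (2018) 343–436, arXiv:1611.06169: Theorem 1.4.1; §8.2
  (Proposition 8.2.2, Remark 8.2.3); §8.3 (Theorem 8.3.1, Proof of Theorem 1.4.1). [Slade2017]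
* T. Hara, T. Hattori, H. Watanabe, Comm. Math. Phys. 220 (2001) 13–40: Theorem 1.1.
  [HaraHattoriWatanabe2001]
-/

noncomputable section

namespace Literature.Barriers.CriticalPhenomena

/-! ### The narrowed barrier collapses onto Slade's Theorem 1.4.1 -/

/-- **The narrowed barrier from the original one**: with Hara–Hattori–Watanabe's Theorem 1.1
proved (`HaraHattoriWatanabe2001_thm11_holds`), Slade's Theorem 1.4.1 alone gives
`RigorousRGSmallParameterNarrow`. [cite: Slade2017, Theorem 1.4.1]
[cite: HaraHattoriWatanabe2001, Theorem 1.1] -/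
theorem rigorousRGSmallParameterNarrow_of_rigorousRGSmallParameter
    (h : RigorousRGSmallParameter) : RigorousRGSmallParameterNarrow :=
  ⟨h, HaraHattoriWatanabe2001_thm11_holds⟩

/-- **`RigorousRGSmallParameterNarrow ↔ RigorousRGSmallParameter`** (the second conjunct being a
theorem). [cite: Slade2017, Theorem 1.4.1] [cite: HaraHattoriWatanabe2001, Theorem 1.1] -/
theorem rigorousRGSmallParameterNarrow_iff_rigorousRGSmallParameter :
    RigorousRGSmallParameterNarrow ↔ RigorousRGSmallParameter :=
  ⟨RigorousRGSmallParameterNarrow.rigorousRGSmallParameter,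
    rigorousRGSmallParameterNarrow_of_rigorousRGSmallParameter⟩

/-- **`RigorousRGSmallParameterNarrow ↔` Slade's Theorem 1.4.1** (first display, `n ≥ 1`, as
transcribed in `LongRangePhi4.Slade2017_thm141`). [cite: Slade2017, Theorem 1.4.1] -/
theorem rigorousRGSmallParameterNarrow_iff_thm141 :
    RigorousRGSmallParameterNarrow ↔ LongRangePhi4.Slade2017_thm141 :=
  rigorousRGSmallParameterNarrow_iff_rigorousRGSmallParameter.trans rigorousRGSmallParameter_iff

/-- The narrowed barrier from Slade's Theorem 1.4.1. [cite: Slade2017, Theorem 1.4.1] -/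
theorem rigorousRGSmallParameterNarrow_of_thm141 (h : LongRangePhi4.Slade2017_thm141) :
    RigorousRGSmallParameterNarrow :=
  rigorousRGSmallParameterNarrow_iff_thm141.2 h

/-! ### … and hence follows from the renormalisation-group output alone -/

/-- The narrowed barrier from the conclusions of §8.2–§8.3 in the `ν`-parametrisation
(`LongRangePhi4.Slade2017_susceptibilityDiffIneq`), by the final integration "Proof of
Theorem 1.4.1" (proved, `…SladeReduction`). [cite: Slade2017, §8.3, Proof of Theorem 1.4.1] -/
theorem rigorousRGSmallParameterNarrow_of_susceptibilityDiffIneq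
    (h : LongRangePhi4.Slade2017_susceptibilityDiffIneq) : RigorousRGSmallParameterNarrow :=
  rigorousRGSmallParameterNarrow_of_rigorousRGSmallParameter
    (rigorousRGSmallParameter_of_susceptibilityDiffIneq h)

/-- The narrowed barrier from the renormalisation-group output on the critical curve
(`LongRangePhi4.Slade2017_criticalCurve`), by Theorem 8.3.1 and §8.3 (proved,
`…CriticalPoint`). [cite: Slade2017, §8.3 (Theorem 8.3.1 and Proof of Theorem 1.4.1)] -/
theorem rigorousRGSmallParameterNarrow_of_criticalCurve
    (h : LongRangePhi4.Slade2017_criticalCurve) : RigorousRGSmallParameterNarrow :=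
  rigorousRGSmallParameterNarrow_of_rigorousRGSmallParameter
    (rigorousRGSmallParameter_of_criticalCurve h)

/-- **The narrowed barrier from one leaf**: Proposition 8.2.2 as printed
(`LongRangePhi4.Slade2017_prop822`, the finite-volume limits along the critical curve — the
output of the renormalisation-group flow) implies `RigorousRGSmallParameterNarrow`, through the
limit/derivative interchange (`…SusceptibilityLimits`), Theorem 8.3.1 and the final integration
(§8.3), and `HaraHattoriWatanabe2001_thm11_holds`. This is the whole unproved remainder of the
narrowed barrier. [cite: Slade2017, Proposition 8.2.2, §8.2–§8.3]
[cite: HaraHattoriWatanabe2001, Theorem 1.1] -/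
theorem rigorousRGSmallParameterNarrow_of_prop822 (h : LongRangePhi4.Slade2017_prop822) :
    RigorousRGSmallParameterNarrow :=
  rigorousRGSmallParameterNarrow_of_rigorousRGSmallParameter (rigorousRGSmallParameter_of_prop822 h)

end Literature.Barriers.CriticalPhenomena

end
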